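import Summits.BirchSwinnertonDyer.BirchSwinnertonDyer.Theorems.GenusKolyvaginAtTwoPowDvdShaCardAtTwoRTCrossPairVanishing
import Summits.BirchSwinnertonDyer.BirchSwinnertonDyer.Theorems.GenusKolyvaginAtTwoPowDvdShaCardAtTwoRTCrossPairNaturality
import Summits.BirchSwinnertonDyer.BirchSwinnertonDyer.Theorems.GenusKolyvaginAtTwoPowDvdShaCardAtTwoRTKummerLevelKernel
import HarnessLib

/-!
# Route `GenusKolyvaginAtTwo`, crux L_T `PowDvdShaCardAtTwoRT` (stmt-BirchSwinnertonDyer-23299), LINE 18, road (E4) — socket X-ORTH: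
# THE CROSS LOCAL TERM OF McCALLUM'S PROP. 4.7 IS ZERO, with no displayed local structure: at a deep inert Kolyvagin place `λ` of the level of the
# first class (sign `s`) not dividing the level of the second (sign `−s`), every first-case datum has `t_λ(D) = 0`

Seat `bsd-line-gk2-p4` g20 (WIDTH-5 attach, cell `bsd-f1-sign2`), `--supports` the crux L_T (helper; closes nothing).  THEOREMS ONLY (no
definition, no named fact, no `sorry`); BSD is not proved by any of this; neither is L_T nor any stub.

WHY (memo `Cruxes/PowDvdShaCardAtTwoRT/Lines/plus-descent-deep-orthogonality-gk2p4.md` §2–§4, §7).  Assembles `…RTCrossPairVanishing` §3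
(the cross term vanishes given «`β′_λ` is `(−s)`-eigen modulo `m·𝓛_λ`») with the two generic inputs that produce that clause from the datum:
`…RTCrossPairNaturality` (`σ_*` commutes with `[m]_*`; the sign of the level-`m` preimage `b′` is the sign of `t = ι_* b′`) and
`…RTKummerLevelKernel` (`ker [m]_* ∩ 𝓛^{(m²)} = m·𝓛^{(m²)}`).
* `exists_mem_kummer_conjActPlace_add_smul_eq_zsmul` — for a first-case datum `D` whose second Selmer class `b′` has `τ_*`-sign `−s`, at a
  `τ`-fixed finite place `λ`: `σ_*β′_λ + s·β′_λ = m·Y′` for some `Y′ ∈ 𝓛_λ^{(m²)}`.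
* **`firstCase_localTerm_eq_zero_of_cross_of_sign`** — THE CROSS TERM: `m·m = 2^M`, `λ ∋ ℓ` deep inert Kolyvagin (`Δ < 0`, `1 ≤ M ≤ M(ℓ)`,
  `FrobEqFrobInfty W K (2^M) ℓ`, `τ•λ = λ`), `e` lift-equivariant, `inv` conj-compatible; `τ_* b₁ = s·b₁`, `m • loc_λ b₁ = 0` (own prime of
  `z = m • b₁`), `τ_* b′ = −(s·b′)` ⟹ `t_λ(D) = 0`.
* `firstCase_localTerm_eq_zero_of_cross_of_sign_inclKD` — the same with the sign read on `t = ι_* b′` at level `m²` (`τ_* t = −(s·t)`,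
  `E(K)` without `m`-torsion), the form in which the LINE's Kolyvagin classes carry their signs (`sign_conjAct_kolyvaginClass_two`).
* §2 **`ctLevelPairing_pullback_eq_zero_of_opposite_signs`** — X-ORTH FOR ONE PAIR: the place bookkeeping (Kummer off `Sn`, `loc b′ = 0` on `Sn′`,
  CROSS on `Sn ∖ Sn′`) over `…CrossPairVanishing` §2 ⟹ `B(ι z, ι t) = 0`.
What X-ORTH still owes after this file: instantiating §2 on the LINE's classes `z_n = 2^(L−e)•c_L(n)` (Selmer off `n` by odd Tamagawa,
`kolyvaginClass_two_mem_selmerLocalKer_of_odd_tamagawaProduct`; own-prime vanishing by Q2; signs by `sign_conjAct_kolyvaginClass_two`; `E[2^L] ⊂ E(K_λ)`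
at primes of index `≥ L`) and the K-side capstone feeding `…RTOrthogonalLadders` (bilinearity: `forall_mem_closure_apply_eq_zero`).

References: [McCallumLMS1991] §4 Prop. 4.7, §5 Lemma 5.3; [MilneADT2006] I §6 proof of Prop. 6.9; [Howard2004HeegnerKolyvagin] Lemma 1.5.3.
-/

set_option autoImplicit false

noncomputable section

open scoped Classical
open scoped AddSubgroup
open Function Field NumberField IsDedekindDomain WeierstrassCurve
open Literature.NumberTheory.EllipticCurves Literature.NumberTheory.GaloisRepresentations
open Literature.NumberTheory.GaloisCohomology
open Literature.NumberTheory.Automorphic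
open Summit.BirchSwinnertonDyer.Rank1Residual.X11b.Relaxation
open Summit.BirchSwinnertonDyer.Rank1Residual.JET.GlobalDuality

-- the Theorems namespace of this sub repeats the summit name by design (D-0017 nested layout)
set_option linter.dupNamespace false

namespace Summit.BirchSwinnertonDyer.BirchSwinnertonDyer.Theorems.GenusExact.PlusDescent

variable (W : WeierstrassCurve ℚ) (K : Type) [Field K] [NumberField K] [W.IsElliptic] [W.IsGloballyMinimal]

omit [W.IsGloballyMinimal] in
/-- **The Kummer lift of a `(−s)`-eigen Selmer class is `(−s)`-eigen modulo `m·𝓛`.**  For a first-case datum `D` at level `m` over the Heegner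
field whose second class satisfies `τ_* b′ = −(s·b′)`, at a `τ`-fixed finite place `λ`: `σ_*β′_λ + s·β′_λ = m·Y′` with `Y′ ∈ 𝓛_λ^{(m²)}`
(`[m]_*` kills `σ_*β′_λ + s·β′_λ` by `…CrossPairNaturality`, and the kernel of `[m]_*` on `𝓛^{(m²)}` is `m·𝓛^{(m²)}` by `…KummerLevelKernel`).
[cite: McCallumLMS1991, §4 Prop. 4.7] [cite: MilneADT2006, Ch. I §6, proof of Prop. 6.9] -/
theorem exists_mem_kummer_conjActPlace_add_smul_eq_zsmul {m : ℕ} [NeZero m] {τ : K ≃ₐ[ℚ] K} {w : HeightOneSpectrum (𝓞 K)}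
    (hfix : τ • w = w) (D : FirstCaseData (W.baseChange K) m) {s : ℤ}
    (hb' : conjAct W τ (m : ℤ) D.b' = -(s • D.b'))
    (βw : galoisCohomology (((W.baseChange K).torsionGaloisModule ((m * m : ℕ) : ℤ)).toLocal (Sum.inr w : Place K)) 1)
    (hβw : βw = D.β' (Sum.inr w)) :
    ∃ Y' : galoisCohomology (((W.baseChange K).torsionGaloisModule ((m * m : ℕ) : ℤ)).toLocal (Sum.inr w : Place K)) 1,
      Y' ∈ (W.baseChange K).kummerSelmerStructure ((m * m : ℕ) : ℤ) (Sum.inr w) ∧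
        conjActPlace W τ ((m * m : ℕ) : ℤ) hfix βw + s • βw = (m : ℤ) • Y' := by
  have hβmem : βw ∈ (W.baseChange K).kummerSelmerStructure ((m * m : ℕ) : ℤ) (Sum.inr w) := hβw ▸ D.β'_mem (Sum.inr w)
  -- `[m]_* βw = loc b′`, which is `(−s)`-eigen
  have hmap : galoisCohomology.map ((mulK (W.baseChange K) m m).restrictField (Place.Completion (Sum.inr w : Place K))) 1 βw =
      galoisCohomology.localization ((W.baseChange K).torsionGaloisModule (m : ℤ)) (Sum.inr w : Place K) 1 D.b' := by
    rw [hβw]; exact D.map_β' (Sum.inr w)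
  have hY : conjActPlace W τ (m : ℤ) hfix
        (galoisCohomology.map ((mulK (W.baseChange K) m m).restrictField (Place.Completion (Sum.inr w : Place K))) 1 βw) =
      (-s) • galoisCohomology.map ((mulK (W.baseChange K) m m).restrictField (Place.Completion (Sum.inr w : Place K))) 1 βw := by
    rw [hmap, conjActPlace_localization_self W τ m hfix D.b', hb', map_neg, map_zsmul, neg_smul]
    rfl
  have hker := map_mulK_conjActPlace_sub_smul_eq_zero W τ hfix m m βw hY
  -- the class `σ_*βw + s·βw` lies in `𝓛` and is killed by `[m]_*`
  have hmem : conjActPlace W τ ((m * m : ℕ) : ℤ) hfix βw - (-s) • βw ∈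
      (W.baseChange K).kummerSelmerStructure ((m * m : ℕ) : ℤ) (Sum.inr w) :=
    AddSubgroup.sub_mem _ (conjActPlace_mem_kummerSelmerStructure W τ ((m * m : ℕ) : ℤ) hfix hβmem) (AddSubgroup.zsmul_mem _ hβmem _)
  obtain ⟨Y', hY', hEq⟩ := exists_eq_zsmul_of_mem_kummer_of_map_mulK_eq_zero (W.baseChange K) (Place.Completion (Sum.inr w : Place K)) m
    hmem hker
  have hEq' : conjActPlace W τ ((m * m : ℕ) : ℤ) hfix βw - (-s) • βw =
      (m : ℤ) • (show galoisCohomology (((W.baseChange K).torsionGaloisModule ((m * m : ℕ) : ℤ)).toLocal (Sum.inr w : Place K)) 1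
        from Y') := hEq
  refine ⟨Y', hY', ?_⟩
  rw [neg_smul, sub_neg_eq_add] at hEq'
  exact hEq'

/-- **THE CROSS LOCAL TERM IS ZERO (signs on the datum).**  Cassels–Tate level `m` with `m·m = 2^M`; `λ ∋ ℓ` a deep inert Kolyvagin place of the
Heegner field (`Δ < 0`, `1 ≤ M ≤ M(ℓ)`, `FrobEqFrobInfty W K (2^M) ℓ`, `τ•λ = λ`), `e` lift-equivariant, `inv` conj-compatible; a first-case datum `D`
with `τ_* b₁ = s·b₁`, `m • loc_λ b₁ = 0` (own prime of the Ш-class `m • b₁`) and `τ_* b′ = −(s·b′)` (opposite sign).  Then `t_λ(D) = 0`.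
[cite: McCallumLMS1991, §4 Prop. 4.7, §5 Lemma 5.3] [cite: Howard2004HeegnerKolyvagin, Lemma 1.5.3] -/
theorem firstCase_localTerm_eq_zero_of_cross_of_sign {m M : ℕ} [NeZero m] [NeZero (m * m)] (hmm : m * m = 2 ^ M)
    (hK : IsImaginaryQuadratic K) (hΔ : W.Δ < 0) {ℓ : ℕ} (hM : 1 ≤ M)
    (hℓ : Zhang2014.IsKolyvaginPrime (W.conductorNorm ℤ) W K 2 ℓ) (hk : M ≤ Zhang2014.kolyvaginIndex W 2 ℓ)
    (hF : FrobEqFrobInfty W K (2 ^ M) ℓ) (w : HeightOneSpectrum (𝓞 K)) (hw : (ℓ : 𝓞 K) ∈ w.asIdeal)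
    {τ : K ≃ₐ[ℚ] K} (hτ1 : τ ≠ 1) (hττ : τ * τ = 1) (hfix : τ • w = w)
    (e : (W.baseChange K).geomTorsion ((m * m : ℕ) : ℤ) → (W.baseChange K).geomTorsion ((m * m : ℕ) : ℤ) → AlgebraicClosure K)
    (hμ : ∀ S T, e S T ^ (m * m) = 1)
    (hadd₁ : ∀ S₁ S₂ T, e (S₁ + S₂) T = e S₁ T * e S₂ T)
    (hadd₂ : ∀ S T₁ T₂, e S (T₁ + T₂) = e S T₁ * e S T₂)
    (hgal : ∀ (γ : absoluteGaloisGroup K) (S T : (W.baseChange K).geomTorsion ((m * m : ℕ) : ℤ)), γ • e S T = e (γ • S) (γ • T))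
    (halt : ∀ T, e T T = 1)
    (hte : ∀ S T, e ((isLiftOfAut_liftAutPlace τ hfix).torsionMap W ((m * m : ℕ) : ℤ) S)
      ((isLiftOfAut_liftAutPlace τ hfix).torsionMap W ((m * m : ℕ) : ℤ) T) = liftAutPlace τ hfix (e S T))
    (inv : LocalInvariants K (m * m)) (hinvc : inv.IsConjCompatible τ)
    (D : FirstCaseData (W.baseChange K) m) {s : ℤ}
    (hb₁ : conjAct W τ ((m * m : ℕ) : ℤ) D.b₁ = s • D.b₁)
    (hmb₁ : (m : ℤ) • galoisCohomology.localization ((W.baseChange K).torsionGaloisModule ((m * m : ℕ) : ℤ)) (Sum.inr w : Place K) 1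
      D.b₁ = 0)
    (hb' : conjAct W τ (m : ℤ) D.b' = -(s • D.b')) :
    D.localTerm e hμ hadd₁ hadd₂ hgal inv (Sum.inr w) = 0 := by
  obtain ⟨Y', hY', hEq⟩ := exists_mem_kummer_conjActPlace_add_smul_eq_zsmul W K hfix D hb' (D.β' (Sum.inr w)) rfl
  exact firstCase_localTerm_eq_zero_of_cross W K hmm hK hΔ hM hℓ hk hF w hw hτ1 hττ hfix e hμ hadd₁ hadd₂ hgal halt hte inv hinvc D hb₁
    hmb₁ rfl hY' hEq

/-- **THE CROSS LOCAL TERM IS ZERO (sign read on `t = ι_* b′`).**  As `firstCase_localTerm_eq_zero_of_cross_of_sign`, with the sign of the second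
class given on `t := ι_* D.b′ ∈ H¹(K, E[m²])` (`τ_* t = −(s·t)`) and `E[m]` without non-zero `Γ_K`-fixed points (so `ι_*` reflects signs,
`conjAct_eq_smul_of_map_inclKD_eq`) — the currency of the LINE's Kolyvagin classes (`sign_conjAct_kolyvaginClass_two`).
[cite: McCallumLMS1991, §4 Prop. 4.7, §5 Lemma 5.3] [cite: GrossLMS1991, §5 Prop. 5.4] -/
theorem firstCase_localTerm_eq_zero_of_cross_of_sign_inclKD {m M : ℕ} [NeZero m] [NeZero (m * m)] (hmm : m * m = 2 ^ M)
    (hK : IsImaginaryQuadratic K) (hΔ : W.Δ < 0) {ℓ : ℕ} (hM : 1 ≤ M)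
    (hℓ : Zhang2014.IsKolyvaginPrime (W.conductorNorm ℤ) W K 2 ℓ) (hk : M ≤ Zhang2014.kolyvaginIndex W 2 ℓ)
    (hF : FrobEqFrobInfty W K (2 ^ M) ℓ) (w : HeightOneSpectrum (𝓞 K)) (hw : (ℓ : 𝓞 K) ∈ w.asIdeal)
    {τ : K ≃ₐ[ℚ] K} (hτ1 : τ ≠ 1) (hττ : τ * τ = 1) (hfix : τ • w = w)
    (e : (W.baseChange K).geomTorsion ((m * m : ℕ) : ℤ) → (W.baseChange K).geomTorsion ((m * m : ℕ) : ℤ) → AlgebraicClosure K)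
    (hμ : ∀ S T, e S T ^ (m * m) = 1)
    (hadd₁ : ∀ S₁ S₂ T, e (S₁ + S₂) T = e S₁ T * e S₂ T)
    (hadd₂ : ∀ S T₁ T₂, e S (T₁ + T₂) = e S T₁ * e S T₂)
    (hgal : ∀ (γ : absoluteGaloisGroup K) (S T : (W.baseChange K).geomTorsion ((m * m : ℕ) : ℤ)), γ • e S T = e (γ • S) (γ • T))
    (halt : ∀ T, e T T = 1)
    (hte : ∀ S T, e ((isLiftOfAut_liftAutPlace τ hfix).torsionMap W ((m * m : ℕ) : ℤ) S)
      ((isLiftOfAut_liftAutPlace τ hfix).torsionMap W ((m * m : ℕ) : ℤ) T) = liftAutPlace τ hfix (e S T))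
    (inv : LocalInvariants K (m * m)) (hinvc : inv.IsConjCompatible τ)
    (hnofix : ∀ P : geomTorsion (W.baseChange K) (m : ℤ), (∀ g : absoluteGaloisGroup K, g • P = P) → P = 0)
    (D : FirstCaseData (W.baseChange K) m) {s : ℤ}
    (hb₁ : conjAct W τ ((m * m : ℕ) : ℤ) D.b₁ = s • D.b₁)
    (hmb₁ : (m : ℤ) • galoisCohomology.localization ((W.baseChange K).torsionGaloisModule ((m * m : ℕ) : ℤ)) (Sum.inr w : Place K) 1
      D.b₁ = 0)
    {t : galoisCohomology ((W.baseChange K).torsionGaloisModule ((m * m : ℕ) : ℤ)) 1}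
    (hDt : galoisCohomology.map (inclKD (W.baseChange K) m m) 1 D.b' = t) (ht : conjAct W τ ((m * m : ℕ) : ℤ) t = -(s • t)) :
    D.localTerm e hμ hadd₁ hadd₂ hgal inv (Sum.inr w) = 0 := by
  have ht' : conjAct W τ ((m * m : ℕ) : ℤ) t = (-s) • t := by rw [ht, neg_smul]
  have hb' : conjAct W τ (m : ℤ) D.b' = -(s • D.b') := by
    rw [conjAct_eq_smul_of_map_inclKD_eq W τ m hnofix hDt ht', neg_smul]
  exact firstCase_localTerm_eq_zero_of_cross_of_sign W K hmm hK hΔ hM hℓ hk hF w hw hτ1 hττ hfix e hμ hadd₁ hadd₂ hgal halt hte inv hinvc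
    D hb₁ hmb₁ hb'


/-! ## §2 X-ORTH for one Kolyvagin pair: the place bookkeeping -/

section Pair

/-- **X-ORTH FOR ONE PAIR OF OPPOSITE-PARITY KOLYVAGIN Ш-CLASSES.**  Frame: `K` imaginary quadratic, `τ ≠ 1`, `τ² = 1`, `E/ℚ` globally minimal
with `Δ < 0`; Cassels–Tate level `m`, `m·m = 2^M` (`1 ≤ M`), a Weil datum `e` on `E_K[m²]` equivariant for the adapted lift at every CROSS place,
a conj-compatible family `inv` with the Cassels–Tate hypotheses, the pullback `ι : Sel^{(m²)} → Ш[m]`.  Classes: `z = m • (k • c)`, `t ∈ Sel^{(m²)}`,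
`m • t = 0`, of OPPOSITE signs (`τ_*(k•c) = s·(k•c)`, `τ_* t = −(s·t)`); `c` Selmer off the set `Sn` of own places (McCallum Lemma 4.3);
`m • loc_q (k•c) = loc_q z = 0` at `q ∈ Sn` (own primes of the Ш-class `z`, Q2); `loc_q t = 0` and `E[m²] ⊂ E(K_q)` at `q ∈ Sn′` (own places of
`t`); and every `q ∈ Sn ∖ Sn′` is a deep inert Kolyvagin place (`ℓ ∈ q`, `M ≤ M(ℓ)`, `FrobEqFrobInfty W K (2^M) ℓ`, `τ•q = q`, `e` lift-equivariant
there).  Then **`B(ι z, ι t) = 0`**: McCallum's Prop. 4.7 as a SUM of local terms (`…CrossPairVanishing` §2), each of which vanishes —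
Kummer at `v ∉ Sn`, `loc b′ = 0` at `Sn′`, CROSS at `Sn ∖ Sn′` (§1).  With `…RTOrthogonalLadders` (p735742) and bilinearity this is the orthogonality
`B(U, V) = 0` of the two Kolyvagin spans. [cite: McCallumLMS1991, §4 Prop. 4.7, §5 Lemma 5.3, Thm. 5.4] [cite: MilneADT2006, Ch. I §6, Prop. 6.9]
[cite: Kolyvagin1991StructureSha] -/
theorem ctLevelPairing_pullback_eq_zero_of_opposite_signs {m M : ℕ} [NeZero m] [NeZero (m * m)] (hmm : m * m = 2 ^ M)
    (hK : IsImaginaryQuadratic K) (hΔ : W.Δ < 0) (hM : 1 ≤ M) {τ : K ≃ₐ[ℚ] K} (hτ1 : τ ≠ 1) (hττ : τ * τ = 1)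
    (e : (W.baseChange K).geomTorsion ((m * m : ℕ) : ℤ) → (W.baseChange K).geomTorsion ((m * m : ℕ) : ℤ) → AlgebraicClosure K)
    (hμ : ∀ S T, e S T ^ (m * m) = 1)
    (hadd₁ : ∀ S₁ S₂ T, e (S₁ + S₂) T = e S₁ T * e S₂ T)
    (hadd₂ : ∀ S T₁ T₂, e S (T₁ + T₂) = e S T₁ * e S T₂)
    (hgal : ∀ (γ : absoluteGaloisGroup K) (S T : (W.baseChange K).geomTorsion ((m * m : ℕ) : ℤ)), γ • e S T = e (γ • S) (γ • T))
    (halt : ∀ T, e T T = 1)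
    (inv : LocalInvariants K (m * m)) (hinvc : inv.IsConjCompatible τ) (hPT' : inv.SumInvLocalizationEqZero)
    (hH3 : ∀ c₃ : galoisCohomology (DiscreteGaloisModule.mu K (m * m)) 3,
      (∀ v : Place K, galoisCohomology.localization (DiscreteGaloisModule.mu K (m * m)) v 3 c₃ = 0) → c₃ = 0)
    (hfin : ∀ D : GeneralCaseData (W.baseChange K) m e hμ hadd₁ hadd₂ hgal, ∃ S : Finset (Place K), ∀ v ∉ S, D.localTerm inv v = 0)
    (ι : selmerGroup (W.baseChange K) ((m * m : ℕ) : ℤ) →+ ((W.baseChange K).sha)[m])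
    (hι : ∀ z, shaTorsionVal (W.baseChange K) m (ι z) = torsionH1ToH1 (W.baseChange K) ((m * m : ℕ) : ℤ) z)
    (hnofix : ∀ P : geomTorsion (W.baseChange K) (m : ℤ), (∀ g : absoluteGaloisGroup K, g • P = P) → P = 0)
    (z t : selmerGroup (W.baseChange K) ((m * m : ℕ) : ℤ))
    (c : galoisCohomology ((W.baseChange K).torsionGaloisModule ((m * m : ℕ) : ℤ)) 1) (k : ℤ)
    (hz : (z : galH1Torsion (W.baseChange K) ((m * m : ℕ) : ℤ)) = (m : ℤ) • k • c)
    (hmt : (m : ℤ) • (t : galH1Torsion (W.baseChange K) ((m * m : ℕ) : ℤ)) = 0)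
    {s : ℤ} (hsc : conjAct W τ ((m * m : ℕ) : ℤ) (k • c) = s • (k • c))
    (hst : conjAct W τ ((m * m : ℕ) : ℤ) (t : galH1Torsion (W.baseChange K) ((m * m : ℕ) : ℤ)) =
      -(s • (t : galH1Torsion (W.baseChange K) ((m * m : ℕ) : ℤ))))
    (Sn Sn' : Set (HeightOneSpectrum (𝓞 K)))
    (hc : ∀ v : Place K, (∀ q ∈ Sn, v ≠ Sum.inr q) → c ∈ selmerLocalKer (W.baseChange K) (Place.Completion v) ((m * m : ℕ) : ℤ))
    (hmc : ∀ q ∈ Sn, (m : ℤ) • galoisCohomology.localization ((W.baseChange K).torsionGaloisModule ((m * m : ℕ) : ℤ))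
      (Sum.inr q : Place K) 1 (k • c) = 0)
    (ht0 : ∀ q ∈ Sn', galoisCohomology.res ((W.baseChange K).torsionGaloisModule ((m * m : ℕ) : ℤ))
      (Place.Completion (Sum.inr q : Place K)) 1 (t : galH1Torsion (W.baseChange K) ((m * m : ℕ) : ℤ)) = 0)
    (htriv : ∀ q ∈ Sn', ∀ (g : absoluteGaloisGroup (Place.Completion (Sum.inr q : Place K)))
      (Q : geomTorsion (W.baseChange K) ((m * m : ℕ) : ℤ)), absGaloisRestrict K (Place.Completion (Sum.inr q : Place K)) g • Q = Q)
    (hcross : ∀ q ∈ Sn, q ∉ Sn' → ∃ (ℓ : ℕ) (hfix : τ • q = q), Zhang2014.IsKolyvaginPrime (W.conductorNorm ℤ) W K 2 ℓ ∧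
      M ≤ Zhang2014.kolyvaginIndex W 2 ℓ ∧ FrobEqFrobInfty W K (2 ^ M) ℓ ∧ (ℓ : 𝓞 K) ∈ q.asIdeal ∧
      ∀ S T, e ((isLiftOfAut_liftAutPlace τ hfix).torsionMap W ((m * m : ℕ) : ℤ) S)
        ((isLiftOfAut_liftAutPlace τ hfix).torsionMap W ((m * m : ℕ) : ℤ) T) = liftAutPlace τ hfix (e S T)) :
    ctLevelPairing (W.baseChange K) m e hμ hadd₁ hadd₂ hgal inv halt hPT' hH3 hfin (ι z) (ι t) = 0 := by
  -- first-case data for the pair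
  obtain ⟨D, hD₁, hDt⟩ := exists_firstCaseData_kolyvagin z t c k hz hnofix hmt
  refine ctLevelPairing_pullback_eq_zero_of_forall_cases e hμ hadd₁ hadd₂ hgal inv halt hPT' hH3 hfin ι hι z t hz D hD₁ hDt fun v ↦ ?_
  by_cases hv' : ∃ q ∈ Sn', v = Sum.inr q
  · -- own place of `t`: `loc_v b′ = 0`
    obtain ⟨q, hq, rfl⟩ := hv'
    exact Or.inr (Or.inl (D.res_b'_eq_zero_of_map_inclKD_eq hDt (ht0 q hq)
      (map_inclKD_restrictField_injective_of_forall_smul_eq (W.baseChange K) m (Place.Completion (Sum.inr q : Place K)) (htriv q hq))))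
  by_cases hv : ∃ q ∈ Sn, v = Sum.inr q
  · -- cross place: `q ∈ Sn ∖ Sn′`
    obtain ⟨q, hq, rfl⟩ := hv
    have hq' : q ∉ Sn' := fun h ↦ hv' ⟨q, h, rfl⟩
    obtain ⟨ℓ, hfix, hℓ, hk, hF, hw, hte⟩ := hcross q hq hq'
    refine Or.inr (Or.inr ?_)
    have hb₁ : conjAct W τ ((m * m : ℕ) : ℤ) D.b₁ = s • D.b₁ := by rw [hD₁]; exact hsc
    have hmb₁ : (m : ℤ) • galoisCohomology.localization ((W.baseChange K).torsionGaloisModule ((m * m : ℕ) : ℤ))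
        (Sum.inr q : Place K) 1 D.b₁ = 0 := by rw [hD₁]; exact hmc q hq
    exact firstCase_localTerm_eq_zero_of_cross_of_sign_inclKD W K hmm hK hΔ hM hℓ hk hF q hw hτ1 hττ hfix e hμ hadd₁ hadd₂ hgal halt
      hte inv hinvc hnofix D hb₁ hmb₁ hDt hst
  · -- `b₁` is Selmer (Kummer) here
    push Not at hv hv'
    refine Or.inl ?_
    have hcv : c ∈ selmerLocalKer (W.baseChange K) (Place.Completion v) ((m * m : ℕ) : ℤ) := hc v fun q hq h ↦ hv q hq h
    rw [map_zsmul]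
    exact AddSubgroup.zsmul_mem _ (mem_kummerLocalConditionAt_res_of_mem_selmerLocalKer (W.baseChange K) _ _ hcv) k

end Pair

end Summit.BirchSwinnertonDyer.BirchSwinnertonDyer.Theorems.GenusExact.PlusDescent

end
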